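import Mathlib
import Summits.Ventures.HodgeRepro.CMType
import Summits.Ventures.HodgeRepro.HodgeSets
import Summits.Ventures.HodgeRepro.CMRank
import Summits.Ventures.HodgeRepro.Groups
import Summits.Ventures.HodgeRepro.Primitive
import Summits.Ventures.HodgeRepro.MuTable
import Summits.Ventures.HodgeRepro.MuDecide
import Summits.Ventures.HodgeRepro.MuWeightsTransport
import Summits.Ventures.HodgeRepro.MuPairs
import Summits.Ventures.HodgeRepro.MuPairsRank
import Summits.Ventures.HodgeRepro.MuPairsCensusGen
import Summits.Ventures.HodgeRepro.RankCertZ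
import Summits.Ventures.HodgeRepro.RankCensus12a
import Summits.Ventures.HodgeRepro.RankCensus12b

/-! # The pairs theorem across the census: degree 12: `C12`, `D6`, `Dic3` (seat p2; see `MuPairsCensusGen.lean`). -/

set_option autoImplicit false

open Finset
open scoped Pointwise

namespace HodgeRepro

/-- `C12`: every Hodge set of every CM type is a union of antipodal pairs. -/
theorem isPairUnion_C12 {Φ : Finset C12} (hΦ : IsCMType cc_C12 Φ) {Δ : Finset C12}
    (hΔ : IsHodgeSet cc_C12 Φ Δ) : IsPairUnion Φ Δ :=
  isPairUnion_of_cover cc_C12_isComplexConj reps_C12 ranks_C12 (by decide) cmRank_reps_C12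
    (by decide) (by decide) (fun _ h => isCMType_C12_cover h) hΦ hΔ

/-- `D6`: every Hodge set of every CM type is a union of antipodal pairs. -/
theorem isPairUnion_D6 {Φ : Finset D6} (hΦ : IsCMType cc_D6 Φ) {Δ : Finset D6}
    (hΔ : IsHodgeSet cc_D6 Φ Δ) : IsPairUnion Φ Δ :=
  isPairUnion_of_cover cc_D6_isComplexConj reps_D6 ranks_D6 (by decide) cmRank_reps_D6
    (by decide) (by decide) (fun _ h => isCMType_D6_cover h) hΦ hΔ

/-- `Dic3`: every Hodge set of every CM type is a union of antipodal pairs. -/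
theorem isPairUnion_Dic3 {Φ : Finset Dic3} (hΦ : IsCMType cc_Dic3 Φ) {Δ : Finset Dic3}
    (hΔ : IsHodgeSet cc_Dic3 Φ Δ) : IsPairUnion Φ Δ :=
  isPairUnion_of_cover cc_Dic3_isComplexConj reps_Dic3 ranks_Dic3 (by decide) cmRank_reps_Dic3
    (by decide) (by decide) (fun _ h => isCMType_Dic3_cover h) hΦ hΔ

end HodgeRepro
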